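import Summits.QuantumFields.BalabanUV.T4Continuum.Support.SmallFieldDomainsTower

/-!
# T⁴ programme, SUBSTRATE — `Support/SmallFieldDomainsPeriodic`: the TORUS READING of the `ℤ^d` region geometry — periodic domain
# sequences (the universal-cover picture of domains on `T = Π_μ ℤ/N_μ`), periodicity of the point index, of the deep cube core and of
# the domain tower, and the index of a TORUS site as the index of any lift

Audit cell `pub-balaban`, SUBSTRATE cell seat p4; typer MAP v0.2 §4 p4 (2) «… indexed by your `BigDomainSeq`∕`ptIndex` read on the torus».  Companion of
`Support/SmallFieldDomains` (`ptIndex`, `layer`), `…Tower` (`coreCubes`, `domainTower`); same namespace.  The tori of the tree are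
`Fin d → ZMod (N μ)` (`B5Prop11Plancherel.Tor N` in row NE2's vocabulary, `Setup.Site P j` with `N μ = P.sitesPerDir j` in V1 —
`SubstrateBackgroundTransporters.siteTor` is the definitional chart); a subset of the torus is read as an `N`-PERIODIC subset of `ℤ^d`.

WHAT THIS FILE PROVIDES (all `[folklore]`):
 * §1 `SetPeriodic N Ω` (`x + N_μ e_μ ∈ Ω ↔ x ∈ Ω`), closure under the period lattice (`SetPeriodic.add_zsmul_mem_iff`,
   `SetPeriodic.add_mem_iff` for vectors with `N_μ ∣ t_μ`), `univ`∕`empty`∕`inter`∕`diff`∕`compl`;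
 * §2 **`ptIndex_add_eq`**: for a periodic sequence the point index is periodic (so is every layer: `layer_periodic`);
 * §3 **`coreCubes_periodic`** (`s ∣ N_μ`: translations by the period lattice permute the side-`s` cubes) and **`domainTower_periodic`**
   (periodic `Ω₀` and bad sets, `M₁L^j ∣ N_μ` for `j ≤ k` ⇒ every level `≤ k` is periodic);
 * §4 the index of a TORUS site: `liftTor x = (val (x μ))_μ`, `torIndex N k Ω x := ptIndex k Ω (liftTor x)`, and **`ptIndex_lift_eq_torIndex`**:
   for a periodic sequence EVERY integer lift of `x` has that index — the index map `ι k := torIndex …` that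
   `RegularBackgroundLocal.RegularTransportersLocal` takes is thus well defined from a periodic domain tower.
HONEST FRAMING (T4-DAG p. 1).  Set algebra on `ℤ^d`∕`ℤ/N`; no configuration, no estimate.  NOT an estimate of any NE row; spine 0/9 unchanged; NOT
infinite volume, NOT a mass gap, NOT Clay.  HONEST DEPENDENCY: continuum YM on T⁴ ⇐ BetaPertH ∧ nine spine estimates (0/9 proved); BetaPertH ⇐
(D1) ∧ (D4) ∧ CAP+tail; G-an2-4 gates asym, D1 and NE2/3/4.  No `sorry`.
-/

noncomputable section

namespace Summit.QuantumFields.BalabanUV.T4Continuum.SmallFieldDomains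

open Literature.MathematicalPhysics.QuantumFieldTheory.Balaban1983to89.B14DomainGeom

variable {d : ℕ}

/-! ## §1 Periodic subsets of `ℤ^d` -/

/-- `Ω ⊆ ℤ^d` is `N`-PERIODIC (the lift of a subset of the torus `Π_μ ℤ/N_μ`): membership is invariant under `x ↦ x + N_μ e_μ` for every
direction. [folklore] -/
def SetPeriodic (N : Fin d → ℕ) (Ω : Set (Pt d)) : Prop := ∀ (x : Pt d) (μ : Fin d), x + Pi.single μ ((N μ : ℕ) : ℤ) ∈ Ω ↔ x ∈ Ω

namespace SetPeriodic

variable {N : Fin d → ℕ} {Ω Ω' : Set (Pt d)}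

/-- Invariance under `x ↦ x + c·N_μ e_μ` for every integer `c`. [folklore] -/
theorem add_zsmul_single_mem_iff (h : SetPeriodic N Ω) (x : Pt d) (μ : Fin d) (c : ℤ) :
    x + Pi.single μ (c * ((N μ : ℕ) : ℤ)) ∈ Ω ↔ x ∈ Ω := by
  -- induction on `c` (both signs) from the one-step invariance
  have step : ∀ (y : Pt d), y + Pi.single μ ((N μ : ℕ) : ℤ) ∈ Ω ↔ y ∈ Ω := fun y => h y μ
  have key : ∀ (n : ℕ) (y : Pt d), y + Pi.single μ ((n : ℤ) * ((N μ : ℕ) : ℤ)) ∈ Ω ↔ y ∈ Ω := by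
    intro n
    induction n with
    | zero => intro y; simp
    | succ n ih =>
      intro y
      have e : y + Pi.single μ (((n + 1 : ℕ) : ℤ) * ((N μ : ℕ) : ℤ)) =
          (y + Pi.single μ ((n : ℤ) * ((N μ : ℕ) : ℤ))) + Pi.single μ ((N μ : ℕ) : ℤ) := by
        rw [add_assoc, ← Pi.single_add]; congr 1; push_cast; ring_nf
      rw [e, step, ih]
  rcases Int.eq_nat_or_neg c with ⟨n, rfl | rfl⟩
  · exact key n x
  · -- negative multiples: translate back
    have e : x = (x + Pi.single μ (-(n : ℤ) * ((N μ : ℕ) : ℤ))) + Pi.single μ ((n : ℤ) * ((N μ : ℕ) : ℤ)) := by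
      rw [add_assoc, ← Pi.single_add]; simp
    conv_rhs => rw [e]
    exact (key n _).symm

/-- Invariance under translation by any vector of the period lattice (`N_μ ∣ t_μ` for all `μ`). [folklore] -/
theorem add_mem_iff (h : SetPeriodic N Ω) (x t : Pt d) (ht : ∀ μ, ((N μ : ℕ) : ℤ) ∣ t μ) : x + t ∈ Ω ↔ x ∈ Ω := by
  classical
  -- decompose `t = Σ_μ single μ (t μ)` and translate one direction at a time
  have key : ∀ (S : Finset (Fin d)) (y : Pt d), y + ∑ μ ∈ S, (Pi.single μ (t μ) : Pt d) ∈ Ω ↔ y ∈ Ω := by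
    intro S
    induction S using Finset.induction_on with
    | empty => intro y; simp
    | insert μ S hμ ih =>
      intro y
      obtain ⟨c, hc⟩ := ht μ
      have hsingle : (Pi.single μ (t μ) : Pt d) = Pi.single μ (c * ((N μ : ℕ) : ℤ)) := by rw [hc, mul_comm]
      have e : y + ∑ ν ∈ insert μ S, (Pi.single ν (t ν) : Pt d) =
          (y + ∑ ν ∈ S, (Pi.single ν (t ν) : Pt d)) + Pi.single μ (c * ((N μ : ℕ) : ℤ)) := by
        rw [Finset.sum_insert hμ, ← hsingle]; abel
      rw [e, add_zsmul_single_mem_iff h, ih]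
  have ht' : t = ∑ μ ∈ Finset.univ, (Pi.single μ (t μ) : Pt d) := by
    ext i; simp [Finset.sum_apply, Pi.single_apply]
  rw [ht']
  exact key Finset.univ x

/-- The whole lattice is periodic. [folklore] -/
theorem univ (N : Fin d → ℕ) : SetPeriodic N (Set.univ : Set (Pt d)) := fun _ _ => by simp

/-- The empty set is periodic. [folklore] -/
theorem empty (N : Fin d → ℕ) : SetPeriodic N (∅ : Set (Pt d)) := fun _ _ => by simp

/-- Intersections of periodic sets are periodic. [folklore] -/
theorem inter (h : SetPeriodic N Ω) (h' : SetPeriodic N Ω') : SetPeriodic N (Ω ∩ Ω') := fun x μ => by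
  simp only [Set.mem_inter_iff, h x μ, h' x μ]

/-- Differences of periodic sets are periodic. [folklore] -/
theorem diff (h : SetPeriodic N Ω) (h' : SetPeriodic N Ω') : SetPeriodic N (Ω \ Ω') := fun x μ => by
  simp only [Set.mem_sdiff, h x μ, h' x μ]

/-- Complements of periodic sets are periodic. [folklore] -/
theorem compl (h : SetPeriodic N Ω) : SetPeriodic N Ωᶜ := fun x μ => by
  simp only [Set.mem_compl_iff, h x μ]

end SetPeriodic

/-! ## §2 The point index of a periodic sequence is periodic -/

section Index
variable {N : Fin d → ℕ} {k : ℕ} {Ω : ℕ → Set (Pt d)}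

/-- **The point index is periodic** for a periodic sequence (translation by a period-lattice vector). [folklore] -/
theorem ptIndex_add_eq (hΩ : ∀ j, SetPeriodic N (Ω j)) (x t : Pt d) (ht : ∀ μ, ((N μ : ℕ) : ℤ) ∣ t μ) :
    ptIndex k Ω (x + t) = ptIndex k Ω x := by
  classical
  unfold ptIndex
  congr 1
  funext j
  exact propext ((hΩ j).add_mem_iff x t ht)

/-- Every layer of a periodic sequence is periodic. [folklore] -/
theorem layer_periodic (hΩ : ∀ j, SetPeriodic N (Ω j)) (j : ℕ) : SetPeriodic N (layer Ω j) :=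
  (hΩ j).diff (hΩ (j + 1))

end Index

/-! ## §3 Periodicity of the deep cube core and of the domain tower -/

section Core
variable {N : Fin d → ℕ}

/-- Translation by `c·s` in one coordinate shifts the side-`s` cube index by `c` there. [folklore] -/
theorem cubeIdx_add_single_mul (s : ℕ) (hs : 0 < s) (y : Pt d) (μ : Fin d) (c : ℤ) :
    cubeIdx s (y + Pi.single μ (c * (s : ℤ))) = cubeIdx s y + Pi.single μ c := by
  funext i
  simp only [cubeIdx, Pi.add_apply]
  by_cases hi : i = μ
  · subst hi
    simp only [Pi.single_eq_same]
    have hs' : (s : ℤ) ≠ 0 := by exact_mod_cast hs.ne'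
    rw [Int.add_mul_ediv_right _ _ hs']
  · simp [Pi.single_eq_of_ne hi]

/-- Transport of core membership along a translation by `c·s` in one coordinate that leaves `X` invariant. [folklore] -/
theorem coreCubes_add_single {s : ℕ} (hs : 0 < s) {r : ℤ} {X : Set (Pt d)} {μ : Fin d} {c : ℤ}
    (hX : ∀ z : Pt d, z + Pi.single μ (c * (s : ℤ)) ∈ X ↔ z ∈ X) {x : Pt d} (hx : x ∈ coreCubes s r X) :
    x + Pi.single μ (c * (s : ℤ)) ∈ coreCubes s r X := by
  intro y hy z hz
  -- pull `y`, `z` back by the translation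
  have hy' : cubeIdx s (y + Pi.single μ ((-c) * (s : ℤ))) = cubeIdx s x := by
    rw [cubeIdx_add_single_mul s hs, hy, cubeIdx_add_single_mul s hs, add_assoc, ← Pi.single_add, add_neg_cancel,
      Pi.single_zero, add_zero]
  have hz' : Within r (y + Pi.single μ ((-c) * (s : ℤ))) (z + Pi.single μ ((-c) * (s : ℤ))) := fun i => by
    simp only [Pi.add_apply, add_sub_add_right_eq_sub]; exact hz i
  have hmem := hx _ hy' _ hz'
  have e : z = (z + Pi.single μ ((-c) * (s : ℤ))) + Pi.single μ (c * (s : ℤ)) := by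
    rw [add_assoc, ← Pi.single_add]; simp
  rw [e]
  exact (hX _).mpr hmem

/-- **The deep cube core of a periodic set is periodic** when the cube side divides the periods. [folklore] -/
theorem coreCubes_periodic {s : ℕ} (hs : 0 < s) (hsN : ∀ μ, s ∣ N μ) (r : ℤ) {X : Set (Pt d)} (hX : SetPeriodic N X) :
    SetPeriodic N (coreCubes s r X) := by
  intro x μ
  obtain ⟨c, hc⟩ := hsN μ
  have hNs : ((N μ : ℕ) : ℤ) = (c : ℤ) * (s : ℤ) := by rw [hc]; push_cast; ring
  have hfwd : ∀ z : Pt d, z + Pi.single μ ((c : ℤ) * (s : ℤ)) ∈ X ↔ z ∈ X := fun z => by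
    rw [← hNs]; exact hX z μ
  have hbwd : ∀ z : Pt d, z + Pi.single μ ((-(c : ℤ)) * (s : ℤ)) ∈ X ↔ z ∈ X := fun z => by
    have := hX.add_zsmul_single_mem_iff z μ (-1)
    rw [hNs] at this
    rw [show (-(c : ℤ)) * (s : ℤ) = -1 * ((c : ℤ) * (s : ℤ)) by ring]
    exact this
  constructor
  · intro h
    have h2 := coreCubes_add_single hs (c := -(c : ℤ)) hbwd h
    rw [hNs, add_assoc, ← Pi.single_add] at h2
    simpa using h2
  · intro h
    rw [hNs]
    exact coreCubes_add_single hs hfwd h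

variable (L M₁ R : ℕ) {Ω₀ : Set (Pt d)} {bad : ℕ → Set (Pt d)}

/-- **The domain tower of periodic data is periodic** at every level `j ≤ k`, provided the big-block sides `M₁L^j` (`j ≤ k`) divide the
periods (e.g. `N_μ = M₁·L^k·c_μ`) and `M₁, L ≥ 1`. [folklore] -/
theorem domainTower_periodic (hM₁ : 0 < M₁) (hL : 0 < L) (hΩ₀ : SetPeriodic N Ω₀) (hbad : ∀ j, SetPeriodic N (bad j)) {k : ℕ}
    (hdiv : ∀ j ≤ k, ∀ μ, M₁ * L ^ j ∣ N μ) : ∀ j ≤ k, SetPeriodic N (domainTower L M₁ R Ω₀ bad j)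
  | 0, _ => by simpa using hΩ₀
  | j + 1, hj => by
    rw [domainTower_succ]
    exact coreCubes_periodic (Nat.mul_pos hM₁ (pow_pos hL _)) (hdiv (j + 1) hj) _
      ((domainTower_periodic hM₁ hL hΩ₀ hbad hdiv j (Nat.le_of_succ_le hj)).diff (hbad j))

/-- Hence the truncated tower is periodic at EVERY level (levels `> k` are empty). [folklore] -/
theorem truncTower_periodic (hM₁ : 0 < M₁) (hL : 0 < L) (hΩ₀ : SetPeriodic N Ω₀) (hbad : ∀ j, SetPeriodic N (bad j)) {k : ℕ}
    (hdiv : ∀ j ≤ k, ∀ μ, M₁ * L ^ j ∣ N μ) (j : ℕ) : SetPeriodic N (truncTower L M₁ R Ω₀ bad k j) := by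
  by_cases hj : j ≤ k
  · rw [truncTower_of_le _ _ _ _ _ hj]; exact domainTower_periodic L M₁ R hM₁ hL hΩ₀ hbad hdiv j hj
  · rw [truncTower_of_lt _ _ _ _ _ (by omega)]; exact SetPeriodic.empty N

end Core

/-! ## §4 The index of a torus site -/

section Torus
variable {N : Fin d → ℕ} [∀ μ, NeZero (N μ)]

/-- The canonical integer lift of a torus site: coordinates `val (x μ) ∈ [0, N_μ)`. [folklore] -/
def liftTor (x : (μ : Fin d) → ZMod (N μ)) : Pt d := fun μ => ((x μ).val : ℤ)

/-- The lift projects back to the site. [folklore] -/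
theorem cast_liftTor (x : (μ : Fin d) → ZMod (N μ)) (μ : Fin d) : ((liftTor x μ : ℤ) : ZMod (N μ)) = x μ := by
  simp [liftTor]

omit [∀ μ, NeZero (N μ)] in
/-- Two integer lifts of the same torus site differ by a period-lattice vector. [folklore] -/
theorem dvd_sub_of_cast_eq {y y' : Pt d} (h : ∀ μ, ((y μ : ℤ) : ZMod (N μ)) = ((y' μ : ℤ) : ZMod (N μ))) (μ : Fin d) :
    ((N μ : ℕ) : ℤ) ∣ y μ - y' μ :=
  (ZMod.intCast_eq_intCast_iff_dvd_sub (y' μ) (y μ) (N μ)).mp (h μ).symm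

/-- THE INDEX OF A TORUS SITE for a (periodic) domain sequence on the cover: the point index of its canonical lift. [folklore] -/
def torIndex (N : Fin d → ℕ) [∀ μ, NeZero (N μ)] (k : ℕ) (Ω : ℕ → Set (Pt d)) (x : (μ : Fin d) → ZMod (N μ)) : ℕ :=
  ptIndex k Ω (liftTor x)

/-- **WELL-DEFINEDNESS ON THE TORUS**: for a periodic sequence, EVERY integer lift `y` of the site `x` has index `torIndex … x`. [folklore] -/
theorem ptIndex_lift_eq_torIndex {k : ℕ} {Ω : ℕ → Set (Pt d)} (hΩ : ∀ j, SetPeriodic N (Ω j)) {y : Pt d}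
    {x : (μ : Fin d) → ZMod (N μ)} (hy : ∀ μ, ((y μ : ℤ) : ZMod (N μ)) = x μ) : ptIndex k Ω y = torIndex N k Ω x := by
  unfold torIndex
  have hdiff : ∀ μ, ((N μ : ℕ) : ℤ) ∣ (y - liftTor x) μ := fun μ => by
    rw [Pi.sub_apply]
    exact dvd_sub_of_cast_eq (fun μ => by rw [hy μ, cast_liftTor]) μ
  have e : y = liftTor x + (y - liftTor x) := by abel
  rw [e]
  exact ptIndex_add_eq hΩ _ _ hdiff

/-- The torus index never exceeds `k`. [folklore] -/
theorem torIndex_le (k : ℕ) (Ω : ℕ → Set (Pt d)) (x : (μ : Fin d) → ZMod (N μ)) : torIndex N k Ω x ≤ k :=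
  ptIndex_le k Ω _

end Torus

end Summit.QuantumFields.BalabanUV.T4Continuum.SmallFieldDomains
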